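/-
Copyright: statement-level skeleton of a published paper (lit-balaban cell, Phase-2 proof seat p25, gen 22). No proof
claims beyond what the kernel checks below.
-/
import Literature.MathematicalPhysics.QuantumFieldTheory.BalabanImbrieJaffe1984to88.BIJ88WalkGeometryZd

/-!
# `BalabanImbrieJaffe1984to88.BIJ88WalkSplit245GeometryZd` — T. Bałaban, J. Imbrie, A. Jaffe, *Effective action and
cluster properties of the abelian Higgs model*, Commun. Math. Phys. **114** (1988) 257–315 [BalabanImbrieJaffe1988],
Sect. 2 p. 264 [PDF 8], verbatim: *"Let X be a connected union of r(e_k)-cubes … The local part C^{(k)}_{Λ,loc}(u; x₁,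
x₂) … vanishes for |x₁ − x₂| > ½r(e_k) … The operator C^{(k)}_{Λ,X}(u) … vanishes unless both arguments are in X"*
and p. 265: *"Here and elsewhere, |X| refers to the number of r(e_k)-cubes in X, not the volume of X."* ([6] (2.13):
*"|j − j′| = max_μ|j_μ − j′_μ|"*) — **THE SITE/CUBE GEOMETRY OF PRINT'S SPLIT ON `ℤ^d`** (p25 gen 22; support file for
the (2.45)-split members of row C2.Claim@312 (W6b/W6b′), owner r16, referee ref-5; dictionary of p36's
`BIJ88WalkGeometryZd`; nothing of record changed).

The (2.45)-split instance of the head (`BIJ88WalkIneq312Split245.ineq312_remainder_bdry_split245` and its decay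
variant) carries four LATTICE-GEOMETRY hypotheses on the sites of the model: `hblk` (a site of the block of a label lies
in a cube equal or adjacent to the label's cube), `hnear` (sites within `½r(e_k)` have touching cubes), `hD` (touching
has degree `≤ D`) and `hsc` (at most `s_c` sites per cube).  Here the underlying `ℤ^d` facts are PROVED in p36's
dictionary (sup-distance `supDist`, cube index `cubeIdx` = coordinatewise Euclidean division, site-to-label distance
`ldistZ` with `M′` sites per label unit): cubes of points at sup-distance `< n` touch (`cubeIdx_touch_of_supDist_lt`);
the site cube of scale `ℓM′` of a label corner is the label cube of scale `ℓ` (`cubeIdx_smul`); a site of the block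
`ldistZ ≤ M′t` of a label, `t < ℓ`, has a cube touching the label's cube (`touch_cube_of_ldistZ_le`); at most `n^d`
injectively positioned sites share a cube index of scale `n` (`card_filter_cubeIdx_eq_le`); touching has degree
`≤ 3^d` over all cubes (`card_touch_univ_le`).

statement-level skeleton of published theorems with citation tags; proofs where landed; nothing here is a claim
about the Yang–Mills mass gap

PDF held: `paper:balaban1988-cmp114-bij-abelian-higgs-effective-action` (journal page = PDF page + 256); pp. 264–265 =
PDF 8–9.

CITATION HEADER (lean-in-tree rule).  lit-balaban cell (HOME `run/shared/lean/pub/lit-balaban/`), Phase 2, seat p25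
gen 22; support of row **C2.Claim@312** (owner r16, referee ref-5), reader of rows C2.Eq2.43–2.46 (owner r18).  USED
BY NAME, nothing restated: `BIJ88WalkGeometryZd.{supDist, cubeIdx, Cube, cubeOf, ldistZ, le_supDist_of_not_touch,
card_touch_le, supDist_comm}` (p36), `Balaban1983to89.B4RandomWalk213.cubeAdj`.

## What is proved (0 `sorry`, standard axioms, no new `Prop` facts; theorems only, no definitions)

* `cubeIdx_touch_of_supDist_lt`, `cubeIdx_smul`, `touch_cube_of_ldistZ_le`, `card_filter_cubeIdx_eq_le`,
  `card_touch_univ_le`.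
HONEST SCOPE: [folklore] lattice geometry in [6]'s sup-metric; the identification of the §5.13 model's abstract sites
with points of `ℤ^d` (an injective position map) is data of the eventual consumer, not made here.  NOT summit
progress; NOT continuum; NOT Clay.  Imports `BIJ88WalkGeometryZd`; modifies nothing.
-/

namespace Literature.MathematicalPhysics.QuantumFieldTheory.BalabanImbrieJaffe1984to88.BIJ88WalkSplit245GeometryZd

open Finset
open Literature.MathematicalPhysics.QuantumFieldTheory.Balaban1983to89.B4RandomWalk213 (cubeAdj)
open BIJ88WalkGeometryZd

variable {dd : ℕ}

/-- **CLOSE POINTS HAVE TOUCHING CUBES**: at sup-distance `< n` the cube indices of scale `n ≥ 1` differ by at most `1`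
in every coordinate (contrapositive of p36's `le_supDist_of_not_touch`) — the mechanism of `hnear` (*"vanishes for
|x₁ − x₂| > ½r(e_k)"*, `½r(e_k) <` cube side). [cite: BalabanImbrieJaffe1988, (2.43) p.264] -/
theorem cubeIdx_touch_of_supDist_lt {n : ℕ} (hn : 0 < n) {x y : Fin dd → ℤ} (h : supDist x y < n) :
    ∀ μ, |cubeIdx n x μ - cubeIdx n y μ| ≤ 1 := by
  by_contra hc
  exact absurd (le_supDist_of_not_touch hn x y hc) (not_le.mpr h)

/-- **SCALING**: the site cube (scale `ℓM′`) of the corner `M′·z` of a label is the label cube (scale `ℓ`) of `z`.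
[folklore] [cite: BalabanImbrieJaffe1988, (2.44) p.264] -/
theorem cubeIdx_smul {ℓ M' : ℕ} (hM : 0 < M') (z : Fin dd → ℤ) :
    cubeIdx (ℓ * M') (fun μ => (M' : ℤ) * z μ) = cubeIdx ℓ z := by
  funext μ
  unfold cubeIdx
  push_cast
  rw [mul_comm (ℓ : ℤ) (M' : ℤ)]
  exact Int.mul_ediv_mul_of_pos _ _ (by exact_mod_cast hM)

/-- **A SITE OF A BLOCK LIES IN A CUBE TOUCHING THE LABEL'S CUBE** (the mechanism of `hblk`): if the site `x` is within
site-distance `M′t` of the label `j` (`ldistZ`, p36's blocks) and `t < ℓ`, then the site cube of `x` (scale `ℓM′`) and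
the label cube of `j` (scale `ℓ`) touch. [cite: BalabanImbrieJaffe1988, (2.44), (2.46) p.264] -/
theorem touch_cube_of_ldistZ_le {ι : Type*} (pos : ι → Fin dd → ℤ) {ℓ M' t : ℕ} (hM : 0 < M') (htℓ : t < ℓ)
    {j : ι} {x : Fin dd → ℤ} (h : ldistZ M' pos j x ≤ M' * t) :
    ∀ μ, |cubeIdx ℓ (pos j) μ - cubeIdx (ℓ * M') x μ| ≤ 1 := by
  have hlt : supDist (fun μ => (M' : ℤ) * pos j μ) x < ((ℓ * M' : ℕ) : ℝ) := by
    unfold ldistZ at h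
    rw [supDist_comm] at h
    have hM' : (0 : ℝ) < M' := by exact_mod_cast hM
    have htℓ' : (t : ℝ) + 1 ≤ ℓ := by exact_mod_cast htℓ
    calc supDist (fun μ => (M' : ℤ) * pos j μ) x ≤ M' * t := h
      _ < M' * ℓ := by nlinarith
      _ = ((ℓ * M' : ℕ) : ℝ) := by push_cast; ring
  have hℓ : 0 < ℓ := lt_of_le_of_lt (Nat.zero_le _) htℓ
  have ht := cubeIdx_touch_of_supDist_lt (Nat.mul_pos hℓ hM) hlt
  rw [cubeIdx_smul hM] at ht
  exact ht

/-- **AT MOST `n^d` SITES PER CUBE** (the mechanism of `hsc`, *"|X| refers to the number of r(e_k)-cubes in X, not the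
volume of X"*): among injectively positioned sites, at most `n^d` have a given cube index of scale `n ≥ 1`.
[cite: BalabanImbrieJaffe1988, Sect. 2 p.265] -/
theorem card_filter_cubeIdx_eq_le {S : Type} [Fintype S] (posS : S → Fin dd → ℤ) (hpos : Function.Injective posS)
    {n : ℕ} (hn : 0 < n) (k : Fin dd → ℤ) :
    (univ.filter fun x => cubeIdx n (posS x) = k).card ≤ n ^ dd := by
  classical
  set F : Finset S := univ.filter fun x => cubeIdx n (posS x) = k with hF
  set T : Finset (Fin dd → ℤ) := Fintype.piFinset fun μ => Finset.Icc ((n : ℤ) * k μ) ((n : ℤ) * k μ + n - 1)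
    with hT
  have hn' : (0 : ℤ) < n := by exact_mod_cast hn
  have h1 : (F.image posS).card = F.card := Finset.card_image_of_injective F hpos
  have h2 : F.image posS ⊆ T := by
    intro z hz
    obtain ⟨x, hx, rfl⟩ := Finset.mem_image.mp hz
    have hk : cubeIdx n (posS x) = k := (Finset.mem_filter.mp hx).2
    rw [hT, Fintype.mem_piFinset]
    intro μ
    have hμ : posS x μ / (n : ℤ) = k μ := congrFun hk μ
    have e := Int.mul_ediv_add_emod (posS x μ) (n : ℤ)
    have r0 := Int.emod_nonneg (posS x μ) hn'.ne'
    have r1 := Int.emod_lt_of_pos (posS x μ) hn'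
    rw [hμ] at e
    rw [Finset.mem_Icc]
    constructor <;> linarith
  have h3 : T.card = n ^ dd := by
    rw [hT, Fintype.card_piFinset]
    rw [Finset.prod_congr rfl fun μ _ => by
      rw [Int.card_Icc, show (n : ℤ) * k μ + n - 1 + 1 - (n : ℤ) * k μ = ((n : ℕ) : ℤ) by ring, Int.toNat_natCast]]
    simp
  calc F.card = (F.image posS).card := h1.symm
    _ ≤ T.card := Finset.card_le_card h2
    _ = n ^ dd := h3

/-- **TOUCHING HAS DEGREE `≤ 3^d` OVER ALL CUBES** (p36's `card_touch_le` on `univ`; the letter `D` of `hnear`'s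
degree and `Δ` of the cube adjacency). [cite: BalabanImbrieJaffe1988, (2.46) p.264] -/
theorem card_touch_univ_le {ι : Type*} [Fintype ι] (pos : ι → Fin dd → ℤ) (ℓ : ℕ) (c : Cube pos ℓ) :
    (univ.filter fun c' => cubeAdj Subtype.val c c').card ≤ 3 ^ dd :=
  card_touch_le pos ℓ c univ

end Literature.MathematicalPhysics.QuantumFieldTheory.BalabanImbrieJaffe1984to88.BIJ88WalkSplit245GeometryZd
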